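import Summits.KontsevichZagierPeriods.KontsevichZagierPeriods.Theses.HurwitzMicroSectors
import Summits.KontsevichZagierPeriods.KontsevichZagierPeriods.Theorems.HurwitzMicroSectorsNormalFormPrinciplePiBoxTransfer
import Summits.KontsevichZagierPeriods.KontsevichZagierPeriods.Theorems.HurwitzMicroSectorsNormalFormPrincipleVariants2239

/-! TTRL-lite variant V2356 of stmt-KontsevichZagierPeriods-3869

Variant V2356 = `stub_boxRigidity` (BoxRigidity: two box-rational representations — domain the open
unit box, integrand `p/q` over `ℚ` — with equal values are KZ-equivalent) under the JOINT small-case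
move `bound_nat:m'≤3; bound_nat:m≤5` (hypotheses read in the order `m ≤ 5 → m' ≤ 3`). Verdict of the
attempt seat: **open** — this file is the exact-strength certificate, not a proof of the variant. As for
every joint bound (`boxRigidityLe_iff_boxVanishing`, file `…Variants2239`: `m ≤ j, m' ≤ k` is
BoxVanishing in the single dimension `max j k`), V2356 is EQUIVALENT to **BoxVanishing in dimension
`5`** — every box-rational representation on `(0,1)⁵` of value `0` is a Kontsevich–Zagier relation, i.e.
Conjecture 1 for box-rational periods of dimension `5`
(`stub_boxRigidity_var2356_iff_boxVanishing_five`: `⇒` compare with the zero representation on the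
`0`-box; `⇐` pad both sides to the `5`-box by unit intervals, `pad_le`, subtract on the common box,
`sub_same`, value `0` by soundness), equivalently to BoxRigidity with BOTH dimensions `≤ 5`
(`stub_boxRigidity_var2356_iff_boxRigidityLe_five`: the bound `m' ≤ 3` is idle next to `m ≤ 5`), hence
to the recorded-open sibling V2343 (`fix_nat:m'=2; bound_nat:m≤5`, also BoxVanishing(`≤ 5`)). By
monotonicity (`boxVanishing_mono`) it contains BoxVanishing in every dimension `≤ 5`
(`boxVanishingLe_five_of_stub_boxRigidity_var2356`): already dimension `2` decides Catalan's
`G = ∫∫ dx dy/(1+x²y²) ∈ ℚ?` and dimension `3` the case split `ζ(3) ∈ ℚ + ℚπ²` in favour of the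
calculus — no argument in the tree or in print proves that; and `KontsevichZagierPeriods → V2356`
(`stub_boxRigidity_var2356_of_statement`), so a refutation of the variant would refute Conjecture 1 for
the tree's calculus (the only invariant of `KZ.relations` in the tree is `eval`; the standing disprover's
bug hunt on the calculus found no defect). The proved two-sided frontier is `max j k ≤ 1` (Baker).
Source: M. Kontsevich, D. Zagier, *Periods* (2001), §1.2 Conjecture 1 and rules 1)–3).
Pure proof file, no definitions. -/

-- `Summit.<Summit>.<Problem>` is the tree's mandated summit-side namespace (CONVENTIONS §2); for this
-- single-conjunct summit the two coincide, so the duplicate is deliberate.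
set_option linter.dupNamespace false

noncomputable section

namespace Summit.KontsevichZagierPeriods.KontsevichZagierPeriods.Theorems

open MeasureTheory Set
open Literature.NumberTheory.Transcendental Literature.NumberTheory.Transcendental.KZ
open Summit.KontsevichZagierPeriods.KontsevichZagierPeriods.Theses.HurwitzMicroSectors
open Summit.KontsevichZagierPeriods.HurwitzMicroSectors.NormalFormPrinciple.PiBox

/-! ## The variant V2356: Conjecture 1 for box-rational periods of dimension 5 -/

/-- **V2356 ⟺ BoxVanishing in dimension `5`** (every box-rational representation on `(0,1)⁵` of value
`0` is a relation): `⇒` compare a box-rational representation on `(0,1)⁵` of value `0` (left slot,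
`m = 5`) with the zero representation on the `0`-box (right slot, `m' = 0 ≤ 3`), itself a relation
(`boxVanishing_of_boxRigidityLe`); `⇐` pad both representations to `(0,1)⁵` and subtract on the common
box, value `0` by soundness (`boxRigidityLe_of_boxVanishing`). The two hypotheses `m ≤ 5`, `m' ≤ 3` are
merely read in the variant's order. [cite: KontsevichZagier2001, §1.2 Conjecture 1] -/
theorem stub_boxRigidity_var2356_iff_boxVanishing_five :
    (∀ (m m' : ℕ) (N : IntegralRep m) (N' : IntegralRep m'), m ≤ 5 → m' ≤ 3 → N.domain = {x | ∀ i, x i ∈ Set.Ioo (0:ℝ) 1} → N.IsRational → N'.domain = {x | ∀ i, x i ∈ Set.Ioo (0:ℝ) 1} → N'.IsRational → N.value = N'.value → Equivalent N N') ↔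
    (∀ N : IntegralRep 5, N.domain = {x | ∀ i, x i ∈ Set.Ioo (0:ℝ) 1} → N.IsRational →
      N.value = 0 → of N ∈ relations) :=
  ⟨fun h => boxVanishing_of_boxRigidityLe (j := 5) (k := 3) (K := 5) le_rfl
      fun m m' N N' hm' hm => h m m' N N' hm hm',
    fun hvan m m' N N' hm hm' =>
      boxRigidityLe_of_boxVanishing (j := 5) (k := 3) (K := 5) le_rfl (by norm_num) hvan m m' N N' hm' hm⟩

/-- **V2356 ⇒ BoxVanishing in every dimension `≤ 5`** (monotonicity of BoxVanishing along padding,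
`boxVanishing_mono`): in particular the recorded-open BoxVanishing(`2`) (Catalan's `G`, `π log 2`,
`log² 2`, `Li₂`/Clausen values against `ℚ`), BoxVanishing(`3`) (`ζ(3)` against `ℚ + ℚπ²`) and
BoxVanishing(`≤ 5`) (sibling V2343). [cite: KontsevichZagier2001, §1.2 Conjecture 1] -/
theorem boxVanishingLe_five_of_stub_boxRigidity_var2356
    (h : ∀ (m m' : ℕ) (N : IntegralRep m) (N' : IntegralRep m'), m ≤ 5 → m' ≤ 3 → N.domain = {x | ∀ i, x i ∈ Set.Ioo (0:ℝ) 1} → N.IsRational → N'.domain = {x | ∀ i, x i ∈ Set.Ioo (0:ℝ) 1} → N'.IsRational → N.value = N'.value → Equivalent N N') :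
    ∀ (m : ℕ) (N : IntegralRep m), m ≤ 5 → N.domain = {x | ∀ i, x i ∈ Set.Ioo (0:ℝ) 1} →
      N.IsRational → N.value = 0 → of N ∈ relations :=
  fun _ N hm => boxVanishing_mono hm (stub_boxRigidity_var2356_iff_boxVanishing_five.1 h) N

/-- **V2356 ⟺ BoxRigidity with both dimensions `≤ 5`**: the bound `m' ≤ 3` is idle next to `m ≤ 5`
(the honest strength of the variant: Conjecture 1 for all pairs of rational integrands over `ℚ` on the
open unit boxes of dimension at most `5`). [cite: KontsevichZagier2001, §1.2 Conjecture 1] -/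
theorem stub_boxRigidity_var2356_iff_boxRigidityLe_five :
    (∀ (m m' : ℕ) (N : IntegralRep m) (N' : IntegralRep m'), m ≤ 5 → m' ≤ 3 → N.domain = {x | ∀ i, x i ∈ Set.Ioo (0:ℝ) 1} → N.IsRational → N'.domain = {x | ∀ i, x i ∈ Set.Ioo (0:ℝ) 1} → N'.IsRational → N.value = N'.value → Equivalent N N') ↔
    (∀ (m m' : ℕ) (N : IntegralRep m) (N' : IntegralRep m'), m ≤ 5 → m' ≤ 5 →
      N.domain = {x | ∀ i, x i ∈ Set.Ioo (0:ℝ) 1} → N.IsRational →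
      N'.domain = {x | ∀ i, x i ∈ Set.Ioo (0:ℝ) 1} → N'.IsRational →
      N.value = N'.value → Equivalent N N') :=
  ⟨fun h m m' N N' hm hm' =>
      boxRigidityLe_of_boxVanishing (j := 5) (k := 5) (K := 5) le_rfl le_rfl
        (stub_boxRigidity_var2356_iff_boxVanishing_five.1 h) m m' N N' hm' hm,
    fun h m m' N N' hm hm' => h m m' N N' hm (hm'.trans (by norm_num))⟩

/-- **V2356 dominates every jointly bounded sibling with `max j k ≤ 5`**: V2356 ⇒
`BoxRigidity(m ≤ j, m' ≤ k)` whenever `max j k ≤ 5` (pad both sides to `(0,1)⁵`, subtract, soundness).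
[cite: KontsevichZagier2001, §1.2 Conjecture 1] -/
theorem boxRigidityLe_of_stub_boxRigidity_var2356 (j k : ℕ) (hjk : max j k ≤ 5)
    (h : ∀ (m m' : ℕ) (N : IntegralRep m) (N' : IntegralRep m'), m ≤ 5 → m' ≤ 3 → N.domain = {x | ∀ i, x i ∈ Set.Ioo (0:ℝ) 1} → N.IsRational → N'.domain = {x | ∀ i, x i ∈ Set.Ioo (0:ℝ) 1} → N'.IsRational → N.value = N'.value → Equivalent N N') :
    ∀ (m m' : ℕ) (N : IntegralRep m) (N' : IntegralRep m'), m ≤ j → m' ≤ k →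
      N.domain = {x | ∀ i, x i ∈ Set.Ioo (0:ℝ) 1} → N.IsRational →
      N'.domain = {x | ∀ i, x i ∈ Set.Ioo (0:ℝ) 1} → N'.IsRational →
      N.value = N'.value → Equivalent N N' :=
  fun m m' N N' hm hm' =>
    boxRigidityLe_of_boxVanishing (le_of_max_le_left hjk) (le_of_max_le_right hjk)
      (stub_boxRigidity_var2356_iff_boxVanishing_five.1 h) m m' N N' hm' hm

/-! ## The other side: the variant is implied by the Summit -/

/-- **The parent leaf ⇒ V2356** (the variant is a specialisation of `stub_boxRigidity`; the converse
is not claimed — the parent is BoxVanishing in ALL dimensions). [cite: KontsevichZagier2001, §1.2 Conjecture 1] -/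
theorem stub_boxRigidity_var2356_of_parent
    (h : ∀ (m m' : ℕ) (N : IntegralRep m) (N' : IntegralRep m'), N.domain = {x | ∀ i, x i ∈ Set.Ioo (0:ℝ) 1} → N.IsRational → N'.domain = {x | ∀ i, x i ∈ Set.Ioo (0:ℝ) 1} → N'.IsRational → N.value = N'.value → Equivalent N N') :
    ∀ (m m' : ℕ) (N : IntegralRep m) (N' : IntegralRep m'), m ≤ 5 → m' ≤ 3 → N.domain = {x | ∀ i, x i ∈ Set.Ioo (0:ℝ) 1} → N.IsRational → N'.domain = {x | ∀ i, x i ∈ Set.Ioo (0:ℝ) 1} → N'.IsRational → N.value = N'.value → Equivalent N N' :=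
  fun m m' N N' _ _ => h m m' N N'

/-- **`KontsevichZagierPeriods ⇒ V2356`**: the variant is a special case of Conjecture 1 for the
tree's calculus (`leaves_of_statement`) — a refutation of the variant would refute the Summit.
[cite: KontsevichZagier2001, §1.2 Conjecture 1] -/
theorem stub_boxRigidity_var2356_of_statement (h : _root_.KontsevichZagierPeriods) :
    ∀ (m m' : ℕ) (N : IntegralRep m) (N' : IntegralRep m'), m ≤ 5 → m' ≤ 3 → N.domain = {x | ∀ i, x i ∈ Set.Ioo (0:ℝ) 1} → N.IsRational → N'.domain = {x | ∀ i, x i ∈ Set.Ioo (0:ℝ) 1} → N'.IsRational → N.value = N'.value → Equivalent N N' :=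
  stub_boxRigidity_var2356_of_parent (leaves_of_statement h).1

end Summit.KontsevichZagierPeriods.KontsevichZagierPeriods.Theorems
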